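import Summits.BirchSwinnertonDyer.BirchSwinnertonDyer.Theorems.GenusKolyvaginAtTwoMinimalTwinBSDTwoSwappedPairSilent
import Summits.BirchSwinnertonDyer.BirchSwinnertonDyer.Theorems.GenusKolyvaginAtTwoMinimalTwinBSDTwoSwappedPairDescent
import Summits.BirchSwinnertonDyer.BirchSwinnertonDyer.Theorems.Rank1ResidualX5TwoDefs
import HarnessLib

/-!
# Route `GenusKolyvaginAtTwo`, crux U₂ `MinimalTwinBSDTwo` (stmt-BirchSwinnertonDyer-22985): THE `ε = −1` DESCENT WITH AN ALL-SILENT TWIN,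
# ANY SIGN OF `Δ`, AT DEPTH `M₀ = ord₂ c + ord₂ C(E)` — an engine of LINE 23's shape for the defect-2 cell `hTw2 = (Δ > 0, ord₂ C = 2)` that
# LINE 24's X⁼² would feed to U₂, and its losslessness

Seat `bsd-line-gk2-p3` g28 (PROVER seat 3/3, cell `bsd-f1-sign2`), `--supports stmt-BirchSwinnertonDyer-22985` (helper; closes nothing).
THEOREMS ONLY (no definition, no named fact, no `sorry`); standard axioms.  **BSD is NOT proved by this file; U₂ / hTw2 are NOT proved; no item
is closed.**  §1–§3 are CONDITIONAL (D-0014) on the four STATEMENT-ONLY published facts the route carries as items (Gross–Zagier 24148, GZK 19921,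
modularity 19273, Milne any-model 24149), exactly as gk2-p2 g23's S3′/S3″ and this seat's `…SwappedPairOneBitDescent` (p766822).

WHY.  The swapped-pair bookkeeping is sign-free once `Ш(E/K)[2^∞] = 0` is known (§0, `…_of_sha_trivial`, the vanishing a HYPOTHESIS); the
vanishing is supplied on `Δ < 0` by the one-bit sandwich (p766610) and for ANY sign by the all-silent sandwich (`…SwappedPairSilent`).  Hence:

* §1 **`swappedPairDescentAtTwo_silent_of_facts`** — `GZ → GZK → modularity → Milne →` for `W/ℚ` globally minimal with `r_an(E) = 1`, `#Sel₂(E) = 2`,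
  ANY sign of `Δ`, ANY `C(E)`; `K` imaginary quadratic, `d_K` odd `≠ −3`, Heegner; ANY datum `Dt` (`c ≠ 0`); `P(1)` of infinite order with
  **`2^(ord₂ c + ord₂ C(E)) ∥ P(1)` in `E(K[1])`**; a globally minimal `2`-Selmer-trivial ALL-SILENT twin (`ord₂ C(Wd) = ord₂ C(E)`):
  **`BSD₂(Wd) → BSD₂(E)`**.  At `C(E)` odd, `Δ > 0` = g23's S3″ (their `ord₂ C(Wd) = 0` budget); at `ord₂ C(E) = 2`, `Δ > 0` = the engine for `hTw2`.
* §2 **`twoDivExponent_eq_of_bsdp_silent`** / `…_of_nonCMAtTwo_silent` — losslessness: the BSD pair (resp. the leaf) force `M₀ = ord₂ c + ord₂ C(E)`.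
* §3 **`hTw2_of_wall_of_reversedSupplySilent_of_facts`** — census composition **`hTw2 ⟸ S1 + S2⁼ + PRINT`** (S2⁼ = the all-silent reversed
  `2`-Selmer-trivial Heegner twin supply at depth `ord₂ c + 2`): IF LINE 24 is adopted, its extra demand on U₂ has the same shape; no new residual.

References: [GrossZagier1986] I.(6.3), V.§2 (2.2); [GrossLMS1991] §2 (2.2), §4, §5 Prop. 5.3; [McCallumLMS1991] §5 Lemma 5.1;
[Milne1972ArithmeticAV] §1 Thm. 1; [Kramer1981] Thm. 1, §2 Prop. 3, Prop. 6; [Miller2011LMS] Def. 1.1.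
-/

set_option autoImplicit false
set_option linter.dupNamespace false -- `Summit.<P>.<Sub>` repeats `BirchSwinnertonDyer` (D-0017)

noncomputable section

open scoped Classical

open WeierstrassCurve NumberField Literature.NumberTheory.EllipticCurves
  Literature.NumberTheory.EllipticCurves.ModularForms
  Literature.NumberTheory.EllipticCurves.Rank1Residual
  Literature.NumberTheory.EllipticCurves.Rank1Residual.Typed
  Literature.NumberTheory.EllipticCurves.KrizLi2019
  Summit.BirchSwinnertonDyer.Rank1Residual
  Summit.BirchSwinnertonDyer.Rank1Residual.AdditivePotMult
  Summit.BirchSwinnertonDyer.BirchSwinnertonDyer.Rank1Residual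
  Summit.BirchSwinnertonDyer.BirchSwinnertonDyer.Theorems.CMExactDescent
  Summit.BirchSwinnertonDyer.BirchSwinnertonDyer.Theorems.GenusExact.TwinSwap
  Summit.BirchSwinnertonDyer.BirchSwinnertonDyer.Theorems.GenusExact.TwinSwap.OneBit

namespace Summit.BirchSwinnertonDyer.BirchSwinnertonDyer.Theorems.GenusExact.TwinSwap.Silent

/-! ## §0 The shared computation with `Ш(E/K)[2^∞] = 0` as a hypothesis (sign-free) -/

/-- **The `2`-adic bookkeeping of a swapped frame with trivial `Ш(E/K)[2^∞]`** (sign-free).  `W/ℚ` globally minimal with `r_an(E) = 1`,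
`#Sel₂(E) = 2`; `K` imaginary quadratic, `d_K` odd `≠ −3`, Heegner for `N_E`; any datum `Dt` (`c ≠ 0`); `d₁` conductor-`1` with `2^(M₀) ∥ P(1)` in
`E(K[1])`; `Wd` a globally minimal `2`-Selmer-trivial twin; HYPOTHESIS `#Ш(E_K)[2^∞] = 1`; PRINT `hGZ` (for `(N_E, W, K)`), `hGZK`, `hmod`.  Then
`r_an(Wd) = 0`, `ord₂ #Ш(E_K) = 0` (finite), `#Ш_an(E_K) = q` with **`ord₂ q = 2 M₀ − 2 ord₂ c − 2 ord₂ C(E)`** (= p766822 §0, sandwich factored out).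
[cite: GrossZagier1986, V.§2 (2.2)] [cite: McCallumLMS1991, §5 Lemma 5.1] -/
theorem padicValRat_shaAn_and_shaOrder_of_swappedPair_of_sha_trivial
    (W : WeierstrassCurve ℚ) [W.IsElliptic] [W.IsGloballyMinimal] [NeZero (W.conductorNorm ℤ)]
    (K : Type) [Field K] [NumberField K]
    (hGZ : gross_zagier (W.conductorNorm ℤ) W K) (hGZK : rank_eq_analyticRank_of_analyticRank_le_one) (hmod : hasEntireLFunction_rat)
    (hr : W.analyticRank = 1) (hSel : Nat.card (W.selmerGroup 2) = 2)
    (hK : IsImaginaryQuadratic K) (hodd : Odd (NumberField.discr K)) (h3 : NumberField.discr K ≠ -3)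
    (hH : SatisfiesHeegnerHypothesis (W.conductorNorm ℤ) K)
    (Dt : ModularParametrizationData W (W.conductorNorm ℤ)) (hc0 : Dt.c ≠ 0) (β : ℤ) (ι : K →+* ℂ)
    (d₁ : KolyvaginHeegnerData Dt β ι 1) (hy : ¬ IsOfFinAddOrder d₁.derivedPoint) {M₀ : ℕ}
    (hdiv : ∃ Q : (W.baseChange (ringClassField K ι 1)).toAffine.Point, ((2 ^ M₀ : ℕ) : ℤ) • Q = d₁.derivedPoint)
    (hndiv : ¬ ∃ Q : (W.baseChange (ringClassField K ι 1)).toAffine.Point, ((2 ^ (M₀ + 1) : ℕ) : ℤ) • Q = d₁.derivedPoint)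
    (Wd : WeierstrassCurve ℚ) [Wd.IsElliptic] [Wd.IsGloballyMinimal]
    (Cd : VariableChange ℚ) (hCd : Cd • W.quadraticTwist (NumberField.discr K : ℚ) = Wd)
    (hSel1 : Nat.card (Wd.selmerGroup 2) = 1)
    (hsha : Nat.card (AddCommGroup.primaryComponent (↥(W.baseChange K).sha) 2) = 1) :
    Wd.analyticRank = 0 ∧ (W.baseChange K).analyticRank = 1 ∧ Finite (W.baseChange K).sha ∧
      padicValNat 2 (W.baseChange K).shaOrder = 0 ∧
      ∃ q : ℚ, shaAnOverC (W.baseChange K) = (q : ℂ) ∧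
        padicValRat 2 q = 2 * (M₀ : ℤ) - 2 * (padicValInt 2 Dt.c : ℤ) - 2 * (padicValNat 2 W.tamagawaProduct : ℤ) := by
  haveI : Fact (Nat.Prime 2) := ⟨Nat.prime_two⟩
  haveI hEK : (W.baseChange K).IsElliptic := isElliptic_baseChange' W K
  have h2 : Module.finrank ℚ K = 2 := hK.1
  have hD0 : (NumberField.discr K : ℚ) ≠ 0 := by exact_mod_cast NumberField.discr_ne_zero K
  haveI hEt : (W.quadraticTwist (NumberField.discr K : ℚ)).IsElliptic := W.isElliptic_quadraticTwist hD0
  obtain ⟨-, hDlt⟩ := discr_emod_four_and_lt_of_odd hK hodd h3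
  have hw2 : Units.torsionOrder K = 2 :=
    Literature.NumberTheory.QuadraticFields.Quadratic.torsionOrder_eq_two_of_discr_lt_neg_four h2 hDlt
  -- the Heegner point `P₀ ∈ E(K)` below `P(1)`
  obtain ⟨P₀, Hd, hP₀, hP₀K⟩ := exists_heegnerPoint_map_eq_derivedPoint_one hK hH d₁
  have hPinf : ¬ IsOfFinAddOrder P₀ := by
    intro hfin
    apply hy
    rw [← hP₀K]
    exact (WeierstrassCurve.Affine.Point.map (W' := W)
      (algebraMap K (ringClassField K ι 1)).toRatAlgHom).isOfFinAddOrder hfin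
  -- ranks over `ℚ`: `rank E(K) ≥ 1`, `rank E^(d_K)(ℚ) = 0`, hence `rank E(ℚ) ≥ 1`
  haveI : Module.Finite ℤ (W.baseChange K).toAffine.Point := (W.baseChange K).module_finite_point_holds
  have hK1 : 1 ≤ (W.baseChange K).mordellWeilRank :=
    Literature.NumberTheory.EllipticCurves.one_le_mordellWeilRank_of_not_isOfFinAddOrder (W.baseChange K) inferInstance hPinf
  have hSelT : Nat.card ((W.quadraticTwist (NumberField.discr K : ℚ)).selmerGroup ((2 : ℕ) : ℤ)) = 1 := by
    have h := natCard_selmerGroup_smul (W.quadraticTwist (NumberField.discr K : ℚ)) Cd (n := 2) two_ne_zero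
    rw [hCd] at h
    rw [← h, Nat.cast_ofNat]
    exact hSel1
  obtain ⟨hrkT0, -, -⟩ := rank_eq_zero_and_torsionBy_eq_bot_and_sha_inf_torsionBy_eq_bot_of_natCard_selmerGroup_eq_one
    (W.quadraticTwist (NumberField.discr K : ℚ)) 2 hSelT
  have hrk : 1 ≤ W.mordellWeilRank := by
    have hsum := W.mordellWeilRank_baseChange_of_finrank_eq_two_of_finite K h2
    rw [hrkT0, add_zero] at hsum
    rw [← hsum]
    exact hK1
  -- `E(ℚ)[2] = 0`, hence `E(K[1])[2^M] = 0` and `E(K)[2] = 0`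
  obtain ⟨-, hT2, -⟩ := rank_eq_one_and_sha_primary_eq_zero_of_natCard_selmerGroup_eq_two W hSel hrk
  have hT2' : ∀ P : W.toAffine.Point, 2 • P = 0 → P = 0 := fun P hP ↦ by convert hT2 P (by convert hP)
  have htor1 : ∀ (M : ℕ) (R : (W.baseChange (ringClassField K ι 1)).toAffine.Point),
      ((2 ^ M : ℕ) : ℤ) • R = 0 → R = 0 :=
    fun M R hR ↦ eq_zero_of_two_pow_smul_eq_zero_ringClassField_of_noTwoTorsion W hK hodd hH hT2' ι M R hR
  have hiv : ∀ x : (W.baseChange K).toAffine.Point, 2 • x = 0 → x = 0 := fun x hx ↦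
    forall_two_zsmul_baseChange_eq_zero_of_heegner W K hK hodd hH hT2' x (by rw [← natCast_zsmul] at hx; exact_mod_cast hx)
  -- analytic ranks
  have hrt : (W.quadraticTwist (NumberField.discr K : ℚ)).analyticRank = 0 :=
    analyticRank_twist_eq_zero_of_rankOne W K hGZ hmod hK hH hr ⟨Dt, Hd, ι, hP₀⟩ hPinf
  have hrd : Wd.analyticRank = 0 := by rw [← hCd, analyticRank_smul, hrt]
  have hrK : (W.baseChange K).analyticRank = 1 :=
    (P2.analyticRank_baseChange_eq_one_iff W K hmod h2).mpr (Or.inl ⟨hr, hrt⟩)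
  -- Gross–Zagier over `K`
  obtain ⟨hrkK, hShaK, -, hshaC⟩ := shaAnOverC_baseChange_eq_of_heegner W K Dt Hd ι P₀ hGZ hGZK hmod hK hH hP₀ hc0 hrK
  haveI hfinK : Finite (W.baseChange K).sha := hShaK
  -- `ord₂ [E(K) : ℤP₀] = M₀`
  have hdivK : ∃ Q : (W.baseChange K).toAffine.Point, ((2 ^ M₀ : ℕ) : ℤ) • Q = P₀ :=
    (X11b.Three.Koly.pDiv_one_iff_exists_zsmul_eq hK d₁ P₀ hP₀K 2 M₀ (htor1 M₀)).mp hdiv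
  have hndivK : ¬ ∃ Q : (W.baseChange K).toAffine.Point, ((2 ^ (M₀ + 1) : ℕ) : ℤ) • Q = P₀ :=
    fun h ↦ hndiv ((X11b.Three.Koly.pDiv_one_iff_exists_zsmul_eq hK d₁ P₀ hP₀K 2 (M₀ + 1) (htor1 (M₀ + 1))).mpr h)
  haveI : Finite (AddCommGroup.torsion (W.baseChange K).toAffine.Point) :=
    WeierstrassCurve.finite_torsion_point (W := W.baseChange K)
  obtain ⟨cc, Q, hcQ, hcker⟩ := X11b.RankOne.exists_coord_of_mordellWeilRank_eq_one (W.baseChange K) hrkK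
  have hidx : padicValNat 2 (AddSubgroup.zmultiples P₀).index = M₀ :=
    X11b.Three.Koly.padicValNat_index_zmultiples_eq_of_divisibility (p := 2) cc Q hcQ hcker hiv P₀ hdivK hndivK
  set I := (AddSubgroup.zmultiples P₀).index with hI_def
  have hI0 : I ≠ 0 := fun hI ↦ by
    have hh := P2.torsionOrder_sq_mul_canonicalHeight_eq_index_sq_mul_regulator (W.baseChange K) hrkK P₀ hPinf
    rw [← hI_def, hI, Nat.cast_zero, zero_pow two_ne_zero, zero_mul, mul_eq_zero, pow_eq_zero_iff two_ne_zero,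
      Nat.cast_eq_zero] at hh
    exact hh.elim (W.baseChange K).torsionOrder_pos_holds.ne'
      (fun h0 ↦ hPinf ((Affine.Point.canonicalHeight_eq_zero_iff_holds P₀).mp h0))
  set q : ℚ := 4 * (I : ℚ) ^ 2 /
      ((Dt.c : ℚ) ^ 2 * (Units.torsionOrder K : ℚ) ^ 2 * ((W.tamagawaProduct : ℚ) ^ 2)) with hq_def
  have hcQ0 : (Dt.c : ℚ) ≠ 0 := by exact_mod_cast hc0
  have hcW0 : (W.tamagawaProduct : ℚ) ≠ 0 := by exact_mod_cast W.tamagawaProduct_pos_holds.ne'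
  have hIQ0 : (I : ℚ) ≠ 0 := by exact_mod_cast hI0
  have hq' : q = ((I : ℚ) / ((Dt.c : ℚ) * (W.tamagawaProduct : ℚ))) ^ 2 := by
    rw [hq_def, hw2]
    push_cast
    field_simp
    ring
  have hvc : padicValRat 2 (Dt.c : ℚ) = padicValInt 2 Dt.c := padicValRat.of_int
  have hval : padicValRat 2 q = 2 * (M₀ : ℤ) - 2 * (padicValInt 2 Dt.c : ℤ) - 2 * (padicValNat 2 W.tamagawaProduct : ℤ) := by
    rw [hq', padicValRat.pow, padicValRat.div hIQ0 (mul_ne_zero hcQ0 hcW0),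
      padicValRat.mul hcQ0 hcW0, hvc, padicValRat.of_nat, padicValRat.of_nat, hidx]
    push_cast
    ring
  have hshaV : padicValNat 2 (W.baseChange K).shaOrder = 0 := by
    rw [X11b.Three.Koly.padicValNat_shaOrder_eq (W.baseChange K) 2, hsha]
    simp
  exact ⟨hrd, hrK, hShaK, hshaV, q, hshaC, hval⟩

/-- **`rank E(ℚ) ≥ 1` on a reversed frame** (bookkeeping): `P(1)` of infinite order gives `rank E(K) ≥ 1`, the `2`-Selmer-trivial twin has
rank `0`, and `rank E(K) = rank E(ℚ) + rank E^(d_K)(ℚ)`.  [cite: SilvermanAEC2009, Thm. X.4.2] -/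
theorem one_le_mordellWeilRank_of_reversedFrame
    (W : WeierstrassCurve ℚ) [W.IsElliptic] [W.IsGloballyMinimal] [NeZero (W.conductorNorm ℤ)]
    (K : Type) [Field K] [NumberField K] (hK : IsImaginaryQuadratic K) (hH : SatisfiesHeegnerHypothesis (W.conductorNorm ℤ) K)
    {Dt : ModularParametrizationData W (W.conductorNorm ℤ)} {β : ℤ} (ι : K →+* ℂ) (d₁ : KolyvaginHeegnerData Dt β ι 1)
    (hy : ¬ IsOfFinAddOrder d₁.derivedPoint)
    {Wd : WeierstrassCurve ℚ} [Wd.IsElliptic] (Cd : VariableChange ℚ) (hCd : Cd • W.quadraticTwist (NumberField.discr K : ℚ) = Wd)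
    (hSel1 : Nat.card (Wd.selmerGroup 2) = 1) : 1 ≤ W.mordellWeilRank := by
  haveI : Fact (Nat.Prime 2) := ⟨Nat.prime_two⟩
  haveI hEK : (W.baseChange K).IsElliptic := isElliptic_baseChange' W K
  have h2 : Module.finrank ℚ K = 2 := hK.1
  have hD0 : (NumberField.discr K : ℚ) ≠ 0 := by exact_mod_cast NumberField.discr_ne_zero K
  haveI hEt : (W.quadraticTwist (NumberField.discr K : ℚ)).IsElliptic := W.isElliptic_quadraticTwist hD0
  obtain ⟨P₀, Hd, hP₀, hP₀K⟩ := exists_heegnerPoint_map_eq_derivedPoint_one hK hH d₁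
  have hPinf : ¬ IsOfFinAddOrder P₀ := by
    intro hfin
    apply hy
    rw [← hP₀K]
    exact (WeierstrassCurve.Affine.Point.map (W' := W)
      (algebraMap K (ringClassField K ι 1)).toRatAlgHom).isOfFinAddOrder hfin
  haveI : Module.Finite ℤ (W.baseChange K).toAffine.Point := (W.baseChange K).module_finite_point_holds
  have hK1 : 1 ≤ (W.baseChange K).mordellWeilRank :=
    Literature.NumberTheory.EllipticCurves.one_le_mordellWeilRank_of_not_isOfFinAddOrder (W.baseChange K) inferInstance hPinf
  have hSelT : Nat.card ((W.quadraticTwist (NumberField.discr K : ℚ)).selmerGroup ((2 : ℕ) : ℤ)) = 1 := by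
    have h := natCard_selmerGroup_smul (W.quadraticTwist (NumberField.discr K : ℚ)) Cd (n := 2) two_ne_zero
    rw [hCd] at h
    rw [← h, Nat.cast_ofNat]
    exact hSel1
  obtain ⟨hrkT0, -, -⟩ := rank_eq_zero_and_torsionBy_eq_bot_and_sha_inf_torsionBy_eq_bot_of_natCard_selmerGroup_eq_one
    (W.quadraticTwist (NumberField.discr K : ℚ)) 2 hSelT
  have hsum := W.mordellWeilRank_baseChange_of_finrank_eq_two_of_finite K h2
  rw [hrkT0, add_zero] at hsum
  rw [← hsum]
  exact hK1

/-! ## §1 The `ε = −1` descent with an all-silent twin, any sign, at depth `M₀ = ord₂ c + ord₂ C(E)` -/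

/-- **THE ALL-SILENT SWAPPED DESCENT (any sign) AT DEPTH `ord₂ c + ord₂ C(E)`, MODULO ITS FOUR PUBLISHED INPUTS** `hGZ`, `hGZK`, `hmod`,
`hMilneC`.  For the rank-ONE `2`-Selmer-minimal member `E` (`r_an(E) = 1`, `#Sel₂(E) = 2`, ANY sign of `Δ`, ANY `C(E)`), a Heegner field `K`
(`d_K` odd `≠ −3`), ANY datum `Dt` (`c ≠ 0`), `P(1)` of infinite order with **`2^(ord₂ c + ord₂ C(E)) ∥ P(1)` in `E(K[1])`**, and a globally
minimal `2`-Selmer-TRIVIAL ALL-SILENT twin `Wd ≅ E^(d_K)` (**`ord₂ C(Wd) = ord₂ C(E)`**): **`BSD₂(Wd) → BSD₂(E)`**.  Inside: `Ш(E/K)[2^∞] = 0` by the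
silent sandwich (`…SwappedPairSilent`, unconditional), then §0 and `AdditivePotMult.bsdp_of_pPartOverC_baseChange`.  At `C(E)` odd, `Δ > 0` =
g23's S3″; at `ord₂ C(E) = 2`, `Δ > 0` = the engine for the defect-2 cell `hTw2`.  CONDITIONAL on the four named facts; closes nothing.
[cite: GrossZagier1986, V.§2 (pp. 310–312)] [cite: Milne1972ArithmeticAV, §1 Thm. 1] [cite: McCallumLMS1991, §5 Lemma 5.1]
[cite: Kramer1981, Thm. 1, Prop. 6] [cite: Miller2011LMS, Def. 1.1] -/
theorem swappedPairDescentAtTwo_silent_of_facts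
    (hGZ : ∀ (N : ℕ) [NeZero N] (W : WeierstrassCurve ℚ) (K : Type) [Field K] [NumberField K],
      gross_zagier N W K)
    (hGZK : rank_eq_analyticRank_of_analyticRank_le_one) (hmod : hasEntireLFunction_rat)
    (hMilneC : Milne1972.bsdQuotient_baseChange_quadratic_anyModel) :
    ∀ (W : WeierstrassCurve ℚ) [W.IsElliptic] [W.IsGloballyMinimal] [NeZero (W.conductorNorm ℤ)],
      W.analyticRank = 1 → Nat.card (W.selmerGroup 2) = 2 →
      ∀ (K : Type) [Field K] [NumberField K], IsImaginaryQuadratic K → Odd (NumberField.discr K) →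
      NumberField.discr K ≠ -3 → SatisfiesHeegnerHypothesis (W.conductorNorm ℤ) K →
      ∀ (Dt : ModularParametrizationData W (W.conductorNorm ℤ)), Dt.c ≠ 0 →
      ∀ (β : ℤ) (ι : K →+* ℂ) (d₁ : KolyvaginHeegnerData Dt β ι 1), ¬ IsOfFinAddOrder d₁.derivedPoint →
        (∃ Q : (W.baseChange (ringClassField K ι 1)).toAffine.Point,
          ((2 ^ (padicValInt 2 Dt.c + padicValNat 2 W.tamagawaProduct) : ℕ) : ℤ) • Q = d₁.derivedPoint) →
        (¬ ∃ Q : (W.baseChange (ringClassField K ι 1)).toAffine.Point,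
          ((2 ^ (padicValInt 2 Dt.c + padicValNat 2 W.tamagawaProduct + 1) : ℕ) : ℤ) • Q = d₁.derivedPoint) →
      ∀ (Wd : WeierstrassCurve ℚ) [Wd.IsElliptic] [Wd.IsGloballyMinimal],
        (∃ C : WeierstrassCurve.VariableChange ℚ, C • W.quadraticTwist (NumberField.discr K : ℚ) = Wd) →
        Nat.card (Wd.selmerGroup 2) = 1 →
        padicValNat 2 Wd.tamagawaProduct = padicValNat 2 W.tamagawaProduct →
        BSDp Wd 2 → BSDp W 2 := by
  intro W _ _ _ hr hSel K _ _ hK hodd h3 hH Dt hc0 β ι d₁ hy hdiv hndiv Wd _ _ hWd hSel1 hSil hBd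
  haveI hEK : (W.baseChange K).IsElliptic := isElliptic_baseChange' W K
  have h2 : Module.finrank ℚ K = 2 := hK.1
  obtain ⟨Cd, hCd⟩ := hWd
  have hrk : 1 ≤ W.mordellWeilRank := one_le_mordellWeilRank_of_reversedFrame W K hK hH ι d₁ hy Cd hCd hSel1
  obtain ⟨-, hsha⟩ := natCard_primaryComponent_sha_baseChange_two_eq_one_of_swappedPair_silent W K hK hodd hH hrk hSel Cd hCd
    hSel1 hSil
  obtain ⟨hrd, -, hShaK, hshaV, q, hshaC, hval⟩ := padicValRat_shaAn_and_shaOrder_of_swappedPair_of_sha_trivial W K (hGZ _ W K) hGZK hmod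
    hr hSel hK hodd h3 hH Dt hc0 β ι d₁ hy hdiv hndiv Wd Cd hCd hSel1 hsha
  haveI : Finite (W.baseChange K).sha := hShaK
  have hKin : MissingPPartOverCAt (W.baseChange K) 2 := ⟨q, hshaC, by rw [hval, hshaV]; push_cast; ring⟩
  exact bsdp_of_pPartOverC_baseChange W 2 K Wd hGZK hmod hMilneC hr.le h2 ⟨Cd, hCd⟩
    (by rw [hrd]; exact zero_le_one) hKin hBd

/-! ## §2 Losslessness with a silent twin: the BSD pair forces the depth `M₀ = ord₂ c + ord₂ C(E)` -/

/-- **`BSD₂(E) ∧ BSD₂(Wd)` + PRINT force `M₀ = ord₂ c + ord₂ C(E)`** on the all-silent swapped frame (any sign) with ANY exact exponent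
`2^(M₀) ∥ P(1)`: the exactness-on-the-canonical-model iff (`.mpr`) gives `ord₂ #Ш_an(E_K) = ord₂ #Ш(E_K) = 0` (§0 + silent sandwich), while
`ord₂ #Ш_an(E_K) = 2 M₀ − 2 ord₂ c − 2 ord₂ C(E)`.  CONDITIONAL on the two `BSD₂` and the four named facts; a losslessness statement only.
[cite: GrossZagier1986, V.§2 (2.2)] [cite: Milne1972ArithmeticAV, §1 Thm. 1] [cite: McCallumLMS1991, §5 Lemma 5.1] [cite: Miller2011LMS, Def. 1.1] -/
theorem twoDivExponent_eq_of_bsdp_silent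
    (W : WeierstrassCurve ℚ) [W.IsElliptic] [W.IsGloballyMinimal] [NeZero (W.conductorNorm ℤ)]
    (K : Type) [Field K] [NumberField K]
    (hGZ : gross_zagier (W.conductorNorm ℤ) W K) (hGZK : rank_eq_analyticRank_of_analyticRank_le_one)
    (hmod : hasEntireLFunction_rat) (hMilneC : Milne1972.bsdQuotient_baseChange_quadratic_anyModel)
    (hr : W.analyticRank = 1) (hSel : Nat.card (W.selmerGroup 2) = 2)
    (hK : IsImaginaryQuadratic K) (hodd : Odd (NumberField.discr K)) (h3 : NumberField.discr K ≠ -3)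
    (hH : SatisfiesHeegnerHypothesis (W.conductorNorm ℤ) K)
    (Dt : ModularParametrizationData W (W.conductorNorm ℤ)) (hc0 : Dt.c ≠ 0) (β : ℤ) (ι : K →+* ℂ)
    (d₁ : KolyvaginHeegnerData Dt β ι 1) (hy : ¬ IsOfFinAddOrder d₁.derivedPoint) {M₀ : ℕ}
    (hdiv : ∃ Q : (W.baseChange (ringClassField K ι 1)).toAffine.Point, ((2 ^ M₀ : ℕ) : ℤ) • Q = d₁.derivedPoint)
    (hndiv : ¬ ∃ Q : (W.baseChange (ringClassField K ι 1)).toAffine.Point, ((2 ^ (M₀ + 1) : ℕ) : ℤ) • Q = d₁.derivedPoint)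
    (Wd : WeierstrassCurve ℚ) [Wd.IsElliptic] [Wd.IsGloballyMinimal]
    (hWd : ∃ C : VariableChange ℚ, C • W.quadraticTwist (NumberField.discr K : ℚ) = Wd)
    (hSel1 : Nat.card (Wd.selmerGroup 2) = 1)
    (hSil : padicValNat 2 Wd.tamagawaProduct = padicValNat 2 W.tamagawaProduct)
    (hBW : BSDp W 2) (hBd : BSDp Wd 2) :
    M₀ = padicValInt 2 Dt.c + padicValNat 2 W.tamagawaProduct := by
  haveI hEK : (W.baseChange K).IsElliptic := isElliptic_baseChange' W K
  have h2 : Module.finrank ℚ K = 2 := hK.1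
  obtain ⟨Cd, hCd⟩ := hWd
  have hrk : 1 ≤ W.mordellWeilRank := one_le_mordellWeilRank_of_reversedFrame W K hK hH ι d₁ hy Cd hCd hSel1
  obtain ⟨-, hsha⟩ := natCard_primaryComponent_sha_baseChange_two_eq_one_of_swappedPair_silent W K hK hodd hH hrk hSel Cd hCd
    hSel1 hSil
  obtain ⟨hrd, -, hShaK, hshaV, q, hshaC, hval⟩ := padicValRat_shaAn_and_shaOrder_of_swappedPair_of_sha_trivial W K hGZ hGZK hmod
    hr hSel hK hodd h3 hH Dt hc0 β ι d₁ hy hdiv hndiv Wd Cd hCd hSel1 hsha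
  haveI : Finite (W.baseChange K).sha := hShaK
  obtain ⟨q', hq', hv'⟩ :=
    (missingPPartOverCAt_baseChange_iff_bsdp W 2 K Wd hGZK hmod hMilneC (by rw [hr]) h2 ⟨Cd, hCd⟩
      (by rw [hrd]; exact zero_le_one) hBd).mpr hBW
  have hqq : q' = q := Rat.cast_injective (α := ℂ) (hq'.symm.trans hshaC)
  rw [hqq, hval, hshaV] at hv'
  have h : (2 : ℤ) * (M₀ : ℤ) - 2 * (padicValInt 2 Dt.c : ℤ) - 2 * (padicValNat 2 W.tamagawaProduct : ℤ) = 0 := by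
    exact_mod_cast hv'
  omega

/-- **From the LEAF** (route currency): `NonCMAtTwo` + the four PRINT items force `M₀ = ord₂ c + ord₂ C(E)` on every all-silent swapped frame
of a non-CM `E` (`BSD₂(E)`: analytic rank `1`; `BSD₂(Wd)`: the twin is non-CM of analytic rank `0`).  On the defect-2 cell `hTw2` the exponent
clause of the reversed supply S2⁼ therefore carries no slack.  CONDITIONAL on the leaf; BSD is NOT proved by this.
[cite: GrossZagier1986, V.§2 (2.2)] [cite: Milne1972ArithmeticAV, §1 Thm. 1] [cite: Miller2011LMS, Def. 1.1] -/
theorem twoDivExponent_eq_of_nonCMAtTwo_silent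
    (hleaf : Summit.BirchSwinnertonDyer.BirchSwinnertonDyer.Rank1Residual.NonCMAtTwo)
    (hGZ : ∀ (N : ℕ) [NeZero N] (W : WeierstrassCurve ℚ) (K : Type) [Field K] [NumberField K], gross_zagier N W K)
    (hL : hasEntireLFunction_rat) (hGZK : rank_eq_analyticRank_of_analyticRank_le_one)
    (hMi : Milne1972.bsdQuotient_baseChange_quadratic_anyModel)
    (W : WeierstrassCurve ℚ) [W.IsElliptic] [W.IsGloballyMinimal] [NeZero (W.conductorNorm ℤ)]
    (hcm : ¬ W.HasCM) (hr : W.analyticRank = 1) (hSel : Nat.card (W.selmerGroup 2) = 2)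
    (K : Type) [Field K] [NumberField K] (hK : IsImaginaryQuadratic K) (hodd : Odd (NumberField.discr K))
    (h3 : NumberField.discr K ≠ -3) (hH : SatisfiesHeegnerHypothesis (W.conductorNorm ℤ) K)
    (Dt : ModularParametrizationData W (W.conductorNorm ℤ)) (hc0 : Dt.c ≠ 0) (β : ℤ) (ι : K →+* ℂ)
    (d₁ : KolyvaginHeegnerData Dt β ι 1) (hy : ¬ IsOfFinAddOrder d₁.derivedPoint) {M₀ : ℕ}
    (hdiv : ∃ Q : (W.baseChange (ringClassField K ι 1)).toAffine.Point, ((2 ^ M₀ : ℕ) : ℤ) • Q = d₁.derivedPoint)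
    (hndiv : ¬ ∃ Q : (W.baseChange (ringClassField K ι 1)).toAffine.Point, ((2 ^ (M₀ + 1) : ℕ) : ℤ) • Q = d₁.derivedPoint)
    (Wd : WeierstrassCurve ℚ) [Wd.IsElliptic] [Wd.IsGloballyMinimal]
    (hWd : ∃ C : VariableChange ℚ, C • W.quadraticTwist (NumberField.discr K : ℚ) = Wd)
    (hSel1 : Nat.card (Wd.selmerGroup 2) = 1)
    (hSil : padicValNat 2 Wd.tamagawaProduct = padicValNat 2 W.tamagawaProduct) :
    M₀ = padicValInt 2 Dt.c + padicValNat 2 W.tamagawaProduct := by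
  haveI hEK : (W.baseChange K).IsElliptic := isElliptic_baseChange' W K
  have hD0 : (NumberField.discr K : ℚ) ≠ 0 := by exact_mod_cast NumberField.discr_ne_zero K
  haveI hEt : (W.quadraticTwist (NumberField.discr K : ℚ)).IsElliptic := W.isElliptic_quadraticTwist hD0
  obtain ⟨Cd, hCd⟩ := hWd
  have hBW : BSDp W 2 := hleaf W hcm (by rw [hr])
  have hcmd : ¬ Wd.HasCM := by
    rw [← hCd, hasCM_iff_of_j_eq (((W.quadraticTwist (NumberField.discr K : ℚ)).variableChange_j Cd).trans (W.j_quadraticTwist hD0))]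
    exact hcm
  have hrk : 1 ≤ W.mordellWeilRank := one_le_mordellWeilRank_of_reversedFrame W K hK hH ι d₁ hy Cd hCd hSel1
  obtain ⟨-, hsha⟩ := natCard_primaryComponent_sha_baseChange_two_eq_one_of_swappedPair_silent W K hK hodd hH hrk hSel Cd hCd
    hSel1 hSil
  obtain ⟨hrd, -⟩ := padicValRat_shaAn_and_shaOrder_of_swappedPair_of_sha_trivial W K (hGZ _ W K) hGZK hL
    hr hSel hK hodd h3 hH Dt hc0 β ι d₁ hy hdiv hndiv Wd Cd hCd hSel1 hsha
  have hBd : BSDp Wd 2 := hleaf Wd hcmd (by rw [hrd]; exact zero_le_one)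
  exact twoDivExponent_eq_of_bsdp_silent W K (hGZ _ W K) hGZK hL hMi hr hSel hK hodd h3 hH Dt hc0 β ι d₁ hy hdiv
    hndiv Wd ⟨Cd, hCd⟩ hSel1 hSil hBW hBd


/-! ## §3 Census composition: the defect-2 cell `hTw2` from the rank-`0` wall, the all-silent reversed supply S2⁼ and PRINT -/

/-- **`hTw2 ⟸ S1 + S2⁼ + PRINT` (pure logic over §1).**  With `hS1` — LINE 23's anchor S1 (`MinimalRankZeroBSDTwo`, pen v1.1 text verbatim),
`hS2s` — S2⁼: for `W` non-CM, `r_an = 1`, `#Sel₂ = 2`, `0 < Δ`, `ord₂ C(W) = 2`: some Heegner field `K` (`d_K` odd `≠ −3`), a datum (`c ≠ 0`), a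
conductor-`1` datum with `P(1)` of infinite order and `2^(ord₂ c + 2) ∥ P(1)` in `E(K[1])`, and a globally minimal ALL-SILENT `2`-Selmer-trivial twin
(`#Sel₂(Wd) = 1`, `ord₂ C(Wd) = 2`); and the four PRINT items: **every `W` on the defect-2 cell `hTw2 = (Δ > 0, ord₂ C = 2)` satisfies `BSD₂`** —
the cell LINE 24's X⁼² would feed to U₂.  CONDITIONAL on the displayed hypotheses; BSD is NOT proved; nothing is closed.
[cite: GrossZagier1986, V.§2 (2.2)] [cite: Milne1972ArithmeticAV, §1 Thm. 1] [cite: Miller2011LMS, Def. 1.1] -/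
theorem hTw2_of_wall_of_reversedSupplySilent_of_facts
    (hGZ : ∀ (N : ℕ) [NeZero N] (W : WeierstrassCurve ℚ) (K : Type) [Field K] [NumberField K], gross_zagier N W K)
    (hGZK : rank_eq_analyticRank_of_analyticRank_le_one) (hmod : hasEntireLFunction_rat)
    (hMilneC : Milne1972.bsdQuotient_baseChange_quadratic_anyModel)
    (hS1 : ∀ (W : WeierstrassCurve ℚ) [W.IsElliptic] [W.IsGloballyMinimal],
      ¬ W.HasCM → W.analyticRank = 0 → Nat.card (W.selmerGroup 2) = 1 → BSDp W 2)
    (hS2s : ∀ (W : WeierstrassCurve ℚ) [W.IsElliptic] [W.IsGloballyMinimal] [NeZero (W.conductorNorm ℤ)],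
      ¬ W.HasCM → W.analyticRank = 1 → Nat.card (W.selmerGroup 2) = 2 → 0 < W.Δ → padicValNat 2 W.tamagawaProduct = 2 →
      ∃ (K : Type) (_ : Field K) (_ : NumberField K),
        IsImaginaryQuadratic K ∧ Odd (NumberField.discr K) ∧ NumberField.discr K ≠ -3 ∧
        SatisfiesHeegnerHypothesis (W.conductorNorm ℤ) K ∧
        ∃ (Dt : ModularParametrizationData W (W.conductorNorm ℤ)) (β : ℤ) (ι : K →+* ℂ) (d₁ : KolyvaginHeegnerData Dt β ι 1),
          Dt.c ≠ 0 ∧ ¬ IsOfFinAddOrder d₁.derivedPoint ∧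
          (∃ Q : (W.baseChange (ringClassField K ι 1)).toAffine.Point,
            ((2 ^ (padicValInt 2 Dt.c + 2) : ℕ) : ℤ) • Q = d₁.derivedPoint) ∧
          (¬ ∃ Q : (W.baseChange (ringClassField K ι 1)).toAffine.Point,
            ((2 ^ (padicValInt 2 Dt.c + 2 + 1) : ℕ) : ℤ) • Q = d₁.derivedPoint) ∧
          ∃ (Wd : WeierstrassCurve ℚ) (_ : Wd.IsElliptic) (_ : Wd.IsGloballyMinimal),
            (∃ C : WeierstrassCurve.VariableChange ℚ, C • W.quadraticTwist (NumberField.discr K : ℚ) = Wd) ∧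
            Nat.card (Wd.selmerGroup 2) = 1 ∧ padicValNat 2 Wd.tamagawaProduct = 2) :
    ∀ (W : WeierstrassCurve ℚ) [W.IsElliptic] [W.IsGloballyMinimal], ¬ W.HasCM → W.analyticRank = 1 →
      Nat.card (W.selmerGroup 2) = 2 → 0 < W.Δ → padicValNat 2 W.tamagawaProduct = 2 → BSDp W 2 := by
  intro W _ _ hcm hr hSel hΔ hC2
  haveI : NeZero (W.conductorNorm ℤ) := ⟨(W.conductorNorm_pos_holds).ne'⟩
  obtain ⟨K, iF, iN, hK, hodd, h3, hH, Dt, β, ι, d₁, hc0, hy, hdiv, hndiv, Wd, iE, iM, hWd, hSel1, hDEF2⟩ :=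
    hS2s W hcm hr hSel hΔ hC2
  haveI hEK : (W.baseChange K).IsElliptic := isElliptic_baseChange' W K
  have hD0 : (NumberField.discr K : ℚ) ≠ 0 := by exact_mod_cast NumberField.discr_ne_zero K
  haveI hEt : (W.quadraticTwist (NumberField.discr K : ℚ)).IsElliptic := W.isElliptic_quadraticTwist hD0
  obtain ⟨Cd, hCd⟩ := hWd
  have hSil : padicValNat 2 Wd.tamagawaProduct = padicValNat 2 W.tamagawaProduct := by rw [hC2]; exact hDEF2
  have hdiv' : ∃ Q : (W.baseChange (ringClassField K ι 1)).toAffine.Point,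
      ((2 ^ (padicValInt 2 Dt.c + padicValNat 2 W.tamagawaProduct) : ℕ) : ℤ) • Q = d₁.derivedPoint := by rw [hC2]; exact hdiv
  have hndiv' : ¬ ∃ Q : (W.baseChange (ringClassField K ι 1)).toAffine.Point,
      ((2 ^ (padicValInt 2 Dt.c + padicValNat 2 W.tamagawaProduct + 1) : ℕ) : ℤ) • Q = d₁.derivedPoint := by rw [hC2]; exact hndiv
  -- the twin is non-CM (same `j`) of analytic rank `0`: `BSD₂(Wd)` from S1
  have hcmd : ¬ Wd.HasCM := by
    rw [← hCd, hasCM_iff_of_j_eq (((W.quadraticTwist (NumberField.discr K : ℚ)).variableChange_j Cd).trans (W.j_quadraticTwist hD0))]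
    exact hcm
  have hrk : 1 ≤ W.mordellWeilRank := one_le_mordellWeilRank_of_reversedFrame W K hK hH ι d₁ hy Cd hCd hSel1
  obtain ⟨-, hsha⟩ := natCard_primaryComponent_sha_baseChange_two_eq_one_of_swappedPair_silent W K hK hodd hH hrk hSel Cd hCd
    hSel1 hSil
  obtain ⟨hrd, -⟩ := padicValRat_shaAn_and_shaOrder_of_swappedPair_of_sha_trivial W K (hGZ _ W K) hGZK hmod hr hSel hK hodd h3 hH Dt
    hc0 β ι d₁ hy hdiv' hndiv' Wd Cd hCd hSel1 hsha
  have hBd : BSDp Wd 2 := hS1 Wd hcmd hrd hSel1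
  exact swappedPairDescentAtTwo_silent_of_facts hGZ hGZK hmod hMilneC W hr hSel K hK hodd h3 hH Dt hc0 β ι d₁ hy hdiv' hndiv'
    Wd ⟨Cd, hCd⟩ hSel1 hSil hBd

end Summit.BirchSwinnertonDyer.BirchSwinnertonDyer.Theorems.GenusExact.TwinSwap.Silent

end
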